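import Mathlib
import Literature.NumberTheory.LFunctions.Zhang2022.Section14Eq143TailBounds
import Literature.NumberTheory.LFunctions.Zhang2022.Section14Eq143Shift
import Literature.NumberTheory.LFunctions.Zhang2022.Section7Eq73Edge
import HarnessLib

/-!
# Zhang (2022) §14, (14.3): the tail `Σ_{m>P²}` — moving the segment `𝔍(1)` to `𝔍(𝓛⁹)`

Topic `Literature/NumberTheory/LFunctions/Zhang2022` (Landau–Siegel adjudication tree; verdict-neutral;
cell siegel-zhang, toward the DAG deduction node `Z22:(14.3)` = `Typed.Sec14.DedEq143`).
Y. Zhang, *Discrete mean estimates and the Landau–Siegel zero*, arXiv:2211.02515v1 (2022)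
[Zhang2022LandauSiegel] — **an unrefereed manuscript under adjudication; nothing here bears on its
Theorems 1–2 or on Landau–Siegel zeros.** §14 p. 76 proves (14.3) "similar to the proof of
Proposition 7.1", i.e. by §7 pp. 34–35 (tex L1878–L1892): "`Z(s,ψ)⁻¹ ≪ (pt₀)^{σ−1/2}` for
`3/2 ≤ σ ≤ 𝓛⁹` … Thus, moving the segment to `𝔍(𝓛⁹)` and applying the simple estimate (7.4), we
obtain `∫_{𝔍(1)} Z(s,ψ)⁻¹ (Σ_{m≥P²} …) A(…)ω(s) ds ≪ ε`" (`ε = exp{−c𝓛¹⁰}`).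

This file PROVES the (14.3) twin of that step, `Z22:§7.u017`-type (theorems only; no new definition,
no named fact): `Typed.Sec14.Eq143.tail` — for `|κ*| ≤ Bτ₅` ((14.1)) and `|a*| ≤ B`, eventually in
`D`, for every `ψ ∈ Ψ`,
`‖∫_{𝔍(1)} Z(s,ψχ)⁻¹ (Σ_{m>⌊P²⌋} κ*(m)ψ(m)m^{−s}) (Σ_{n≤⌊2P₄⌋} a*(n)ψ̄(n)n^{s−1}) ω(s) ds‖
≤ e³B²S(max(C₇₄,0) + 4e^{1/4})·e^{−𝓛¹⁰/16}`. Ingredients: Cauchy's theorem on the rectangle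
between `𝔍(1)` and `𝔍(𝓛⁹)` (`Section7aStatements.norm_intJ_sub_intJ_le`); on `3/2 ≤ σ ≤ 𝓛⁹+1/2`
the pointwise bound `|Z⁻¹·tail·A| ≤ e³B²S(P²+1)²·b^σ` with `b = Dpt₀⌊2P₄⌋/(⌊P²⌋+1) ≤ 4Dt₀²T⁻² ≤ T⁻¹`
(`norm_Zfac_inv_le_of_isPrimitive`, `norm_LSeries_tail_le`, `norm_apoly_le_pow`,
`four_D_t0_sq_le_bigT`); `b^σ ≤ 1` on the horizontal sides against `|ω| ≤ 2e^{1/4}e^{−𝓛¹⁰/4}`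
(`Section7aStatements.norm_omegaW_side_le`), `b^{𝓛⁹+1/2} ≤ e^{−𝓛¹⁰}` on `𝔍(𝓛⁹)` against
`∫_{𝔍(𝓛⁹)}|ω||ds| ≤ C₇₄` ((7.4), `Section7aStatements.eq74_holds`).

## References

* Y. Zhang, arXiv:2211.02515v1 (2022), §14 (14.3) p. 76; §7 pp. 34–35, tex L1878–L1892.
  [cite: Zhang2022LandauSiegel, §14 (14.3) p. 76; §7 p. 35 (u017)]
-/

noncomputable section

open Complex Real Set MeasureTheory intervalIntegral
open scoped ComplexConjugate

namespace Literature.NumberTheory.LFunctions.Zhang2022.Typed.Sec14.Eq143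

open Skeleton Section7aStatements Section7Eq73Edge

/-- `2πt₀ − 𝓛₁ > 0` for `𝓛 ≥ 1`. [folklore] -/
private theorem twoPiT0_sub_ell1_pos₃ {D : ℕ} (hℓ : 1 ≤ ell D) : 0 < 2 * π * t0 D - ell1 D := by
  have h1 : ell D ^ 405 ≤ ell D ^ 519 := pow_le_pow_right₀ hℓ (by norm_num)
  have h2 : 1 ≤ ell D ^ 519 := one_le_pow₀ hℓ
  rw [t0, ell1]; nlinarith [Real.pi_gt_three]

/-! ### Real bookkeeping -/

/-- `kt^{σ−1/2}·Y^{5/4−σ}·N^σ ≤ Y^{5/4}·(kt·N/Y)^σ` for `kt, Y ≥ 1`, `N ≥ 0`. [folklore] -/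
private theorem rpow_bookkeeping {kt Y Nr σ : ℝ} (hkt : 1 ≤ kt) (hY : 1 ≤ Y) (hN : 0 ≤ Nr) :
    kt ^ (σ - 1 / 2) * Y ^ (5 / 4 - σ) * Nr ^ σ ≤ Y ^ (5 / 4 : ℝ) * (kt * Nr / Y) ^ σ := by
  have hkt0 : 0 ≤ kt := by linarith
  have hY0 : 0 < Y := by linarith
  have hle : σ - 1 / 2 ≤ σ := by linarith
  have h1 : kt ^ (σ - 1 / 2) ≤ kt ^ σ := Real.rpow_le_rpow_of_exponent_le hkt hle
  have h2 : Y ^ (5 / 4 - σ) = Y ^ (5 / 4 : ℝ) * (Y⁻¹) ^ σ := by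
    rw [show (5 / 4 : ℝ) - σ = 5 / 4 + -σ by ring, Real.rpow_add hY0, Real.rpow_neg hY0.le,
      Real.inv_rpow hY0.le]
  have h3 : (kt * Nr / Y) ^ σ = kt ^ σ * Nr ^ σ * (Y⁻¹) ^ σ := by
    rw [div_eq_mul_inv, Real.mul_rpow (mul_nonneg hkt0 hN) (inv_nonneg.mpr hY0.le),
      Real.mul_rpow hkt0 hN]
  have hA : 0 ≤ Y ^ (5 / 4 - σ) := Real.rpow_nonneg hY0.le _
  have hB : 0 ≤ Nr ^ σ := Real.rpow_nonneg hN _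
  calc kt ^ (σ - 1 / 2) * Y ^ (5 / 4 - σ) * Nr ^ σ ≤ kt ^ σ * Y ^ (5 / 4 - σ) * Nr ^ σ :=
        mul_le_mul_of_nonneg_right (mul_le_mul_of_nonneg_right h1 hA) hB
    _ = Y ^ (5 / 4 : ℝ) * (kt * Nr / Y) ^ σ := by rw [h2, h3]; ring

/-- `b^{𝓛⁹+1/2} ≤ e^{−𝓛¹⁰}` for `0 ≤ b ≤ T⁻¹ = e^{−𝓛^{1.1}}`, `𝓛 ≥ 1`. [folklore] -/
private theorem base_pow_le {D : ℕ} (hℓ : 1 ≤ ell D) {b : ℝ} (hb0 : 0 ≤ b) (hbT : b ≤ (bigT D)⁻¹) :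
    b ^ (ell D ^ 9 + 1 / 2) ≤ Real.exp (-ell D ^ 10) := by
  have hσ1 : 0 ≤ ell D ^ 9 + 1 / 2 := by positivity
  have h9 : 0 ≤ ell D ^ 9 := by positivity
  calc b ^ (ell D ^ 9 + 1 / 2) ≤ ((bigT D)⁻¹) ^ (ell D ^ 9 + 1 / 2) := Real.rpow_le_rpow hb0 hbT hσ1
    _ = Real.exp (-(ell D ^ (1.1 : ℝ)) * (ell D ^ 9 + 1 / 2)) := by
        rw [bigT, ← Real.exp_neg, Real.exp_mul]
    _ ≤ Real.exp (-ell D ^ 10) := by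
        apply Real.exp_le_exp.mpr
        have h11 : ell D ≤ ell D ^ (1.1 : ℝ) := by
          calc ell D = ell D ^ (1 : ℝ) := (Real.rpow_one _).symm
            _ ≤ ell D ^ (1.1 : ℝ) := Real.rpow_le_rpow_of_exponent_le hℓ (by norm_num)
        have h10 : ell D ^ 10 = ell D * ell D ^ 9 := by ring
        have hm : ell D * ell D ^ 9 ≤ ell D ^ (1.1 : ℝ) * (ell D ^ 9 + 1 / 2) :=
          mul_le_mul h11 (by linarith) h9 (le_trans (by linarith) h11)
        rw [h10]; linarith

/-- `(P²+1)² ≤ e^{2+4𝓛⁹}` (`P = e^{𝓛⁹}`). [folklore] -/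
private theorem bigP_sq_add_one_sq_le {D : ℕ} (hℓ : 1 ≤ ell D) :
    (bigP D ^ 2 + 1) ^ 2 ≤ Real.exp (2 + 4 * ell D ^ 9) := by
  have h9 : 0 ≤ ell D ^ 9 := pow_nonneg (le_trans zero_le_one hℓ) 9
  have hP2 : bigP D ^ 2 + 1 ≤ Real.exp (1 + 2 * ell D ^ 9) := by
    have h1 : bigP D ^ 2 = Real.exp (2 * ell D ^ 9) := by rw [bigP, ← Real.exp_nat_mul]; norm_num
    rw [h1, Real.exp_add]
    have h2 : (1 : ℝ) ≤ Real.exp (2 * ell D ^ 9) := Real.one_le_exp (by linarith)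
    nlinarith [Real.add_one_le_exp (1 : ℝ), Real.exp_pos (2 * ell D ^ 9)]
  calc (bigP D ^ 2 + 1) ^ 2 ≤ Real.exp (1 + 2 * ell D ^ 9) ^ 2 := pow_le_pow_left₀ (by positivity) hP2 2
    _ = Real.exp (2 + 4 * ell D ^ 9) := by rw [← Real.exp_nat_mul]; ring_nf

/-- Budget of the right side: `(P²+1)²e^{−𝓛¹⁰} ≤ e^{−𝓛¹⁰/16}` for `𝓛 ≥ 40`. [folklore] -/
private theorem budget_right {D : ℕ} (hℓ : 40 ≤ ell D) :
    (bigP D ^ 2 + 1) ^ 2 * Real.exp (-ell D ^ 10) ≤ Real.exp (-(1 / 16) * ell D ^ 10) := by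
  have hℓ1 : 1 ≤ ell D := le_trans (by norm_num) hℓ
  have h10 : ell D ^ 10 = ell D * ell D ^ 9 := by ring
  have h9 : 1 ≤ ell D ^ 9 := one_le_pow₀ hℓ1
  have hm : 40 * ell D ^ 9 ≤ ell D * ell D ^ 9 := mul_le_mul_of_nonneg_right hℓ (by linarith)
  calc (bigP D ^ 2 + 1) ^ 2 * Real.exp (-ell D ^ 10)
      ≤ Real.exp (2 + 4 * ell D ^ 9) * Real.exp (-ell D ^ 10) :=
        mul_le_mul_of_nonneg_right (bigP_sq_add_one_sq_le hℓ1) (Real.exp_pos _).le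
    _ = Real.exp (2 + 4 * ell D ^ 9 - ell D ^ 10) := by rw [← Real.exp_add]; ring_nf
    _ ≤ Real.exp (-(1 / 16) * ell D ^ 10) := Real.exp_le_exp.mpr (by rw [h10]; linarith)

/-- Budget of the horizontal sides: `(𝓛⁹−1)(P²+1)²e^{−𝓛¹⁰/4} ≤ e^{−𝓛¹⁰/16}` for `𝓛 ≥ 40`. [folklore] -/
private theorem budget_sides {D : ℕ} (hℓ : 40 ≤ ell D) :
    (ell D ^ 9 - 1) * ((bigP D ^ 2 + 1) ^ 2 * Real.exp (-(ell D ^ 10 / 4))) ≤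
      Real.exp (-(1 / 16) * ell D ^ 10) := by
  have hℓ1 : 1 ≤ ell D := le_trans (by norm_num) hℓ
  have h10 : ell D ^ 10 = ell D * ell D ^ 9 := by ring
  have h9 : 1 ≤ ell D ^ 9 := one_le_pow₀ hℓ1
  have hm : 40 * ell D ^ 9 ≤ ell D * ell D ^ 9 := mul_le_mul_of_nonneg_right hℓ (by linarith)
  have hℓ9exp : ell D ^ 9 - 1 ≤ Real.exp (ell D ^ 9) := by linarith [Real.add_one_le_exp (ell D ^ 9)]
  calc (ell D ^ 9 - 1) * ((bigP D ^ 2 + 1) ^ 2 * Real.exp (-(ell D ^ 10 / 4)))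
      ≤ Real.exp (ell D ^ 9) * (Real.exp (2 + 4 * ell D ^ 9) * Real.exp (-(ell D ^ 10 / 4))) :=
        mul_le_mul hℓ9exp (mul_le_mul_of_nonneg_right (bigP_sq_add_one_sq_le hℓ1) (Real.exp_pos _).le)
          (by positivity) (Real.exp_pos _).le
    _ = Real.exp (2 + 5 * ell D ^ 9 - ell D ^ 10 / 4) := by
        rw [← Real.exp_add, ← Real.exp_add]; ring_nf
    _ ≤ Real.exp (-(1 / 16) * ell D ^ 10) := Real.exp_le_exp.mpr (by rw [h10]; linarith)

/-! ### The base `b = Dpt₀·⌊2P₄⌋/(⌊P²⌋+1) ≤ T⁻¹` and the pointwise bound -/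

/-- **`b = Dpt₀⌊2P₄⌋/(⌊P²⌋+1) ≤ 4Dt₀²T⁻² ≤ T⁻¹`** (`p ≤ 2P`, `⌊2P₄⌋ ≤ 2Pt₀T⁻²`, `⌊P²⌋+1 ≥ P²`, and
`4Dt₀² ≤ T`): the base of the `σ`-power in `|Z(s,ψχ)⁻¹|·|tail|·|A| ≪ (Dpt₀)^{σ}(P²)^{−σ}(2P₄)^σ`.
[cite: Zhang2022LandauSiegel, §7 p. 34–35, tex L1878–L1890] -/
theorem base_le_inv_bigT {D : ℕ} (hℓ : 1 ≤ ell D) (hT4 : 4 * (D : ℝ) * t0 D ^ 2 ≤ bigT D)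
    (x : Chr D) :
    ((D * x.p : ℕ) : ℝ) * t0 D * (⌊2 * P4 D⌋₊ : ℝ) / ((⌊bigP D ^ 2⌋₊ : ℝ) + 1) ≤ (bigT D)⁻¹ := by
  have hP0 : 0 < bigP D := bigP_pos D
  have hT1 : 1 ≤ bigT D := by rw [bigT]; exact Real.one_le_exp (by positivity)
  have hT0 : 0 < bigT D := by linarith
  have ht00 : 0 ≤ t0 D := by rw [t0]; exact pow_nonneg (by linarith) _
  have hD' : (0 : ℝ) ≤ D := Nat.cast_nonneg D
  have hp2P : (x.p : ℝ) ≤ 2 * bigP D := le_two_mul_bigP_of_mem_primeWindow hℓ x.mem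
  have hYP : bigP D ^ 2 ≤ (⌊bigP D ^ 2⌋₊ : ℝ) + 1 := (Nat.lt_floor_add_one _).le
  have hkt : ((D * x.p : ℕ) : ℝ) * t0 D ≤ 2 * (D : ℝ) * bigP D * t0 D := by
    push_cast; nlinarith [mul_nonneg hD' ht00]
  have hkt0 : 0 ≤ ((D * x.p : ℕ) : ℝ) * t0 D := mul_nonneg (Nat.cast_nonneg _) ht00
  have hP4 : 0 ≤ 2 * P4 D := by
    rw [P4]; exact mul_nonneg zero_le_two (mul_nonneg (div_nonneg hP0.le (pow_nonneg hT0.le 2)) ht00)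
  have hN : (⌊2 * P4 D⌋₊ : ℝ) ≤ 2 * bigP D * t0 D / bigT D ^ 2 := by
    refine (Nat.floor_le hP4).trans (le_of_eq ?_)
    rw [P4]; ring
  have hC0 : 0 ≤ 2 * (D : ℝ) * bigP D * t0 D :=
    mul_nonneg (mul_nonneg (mul_nonneg zero_le_two hD') hP0.le) ht00
  have h1 : ((D * x.p : ℕ) : ℝ) * t0 D * (⌊2 * P4 D⌋₊ : ℝ) ≤
      (2 * (D : ℝ) * bigP D * t0 D) * (2 * bigP D * t0 D / bigT D ^ 2) :=
    mul_le_mul hkt hN (Nat.cast_nonneg _) hC0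
  have h2 := div_le_div₀ (mul_nonneg hC0 (div_nonneg (mul_nonneg (mul_nonneg zero_le_two hP0.le) ht00)
    (pow_nonneg hT0.le 2))) h1 (pow_pos hP0 2) hYP
  refine h2.trans ?_
  have h3 : (2 * (D : ℝ) * bigP D * t0 D) * (2 * bigP D * t0 D / bigT D ^ 2) / bigP D ^ 2 =
      4 * (D : ℝ) * t0 D ^ 2 / bigT D ^ 2 := by
    field_simp; ring
  rw [h3, div_le_iff₀ (pow_pos hT0 2)]
  have e : (bigT D)⁻¹ * bigT D ^ 2 = bigT D := by
    rw [pow_two, ← mul_assoc, inv_mul_cancel₀ hT0.ne', one_mul]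
  rw [e]; exact hT4

/-- **The pointwise bound on `3/2 ≤ σ ≤ 𝓛⁹ + 1/2`, `|t − 2πt₀| ≤ 𝓛₁`** (§7 p. 34: "`Z(s,ψ)⁻¹ ≪
(pt₀)^{σ−1/2}`", the tail "`≪ P^{2(1−σ)}𝓛ᶜ`", "`A ≪ (PT⁻²)^σ`", multiplied):
`|Z(s,ψχ)⁻¹|·|Σ_{m>⌊P²⌋}κ*ψm^{−s}|·|Σ_{n≤⌊2P₄⌋}a*ψ̄n^{s−1}| ≤ e³B²S(P²+1)²·b^σ`, `b` as in
`base_le_inv_bigT`, given the tail bound with constant `S` (`norm_LSeries_tail_le`).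
[cite: Zhang2022LandauSiegel, §7 p. 34, tex L1878–L1882; §14 (14.3) p. 76] -/
theorem norm_Zinv_tail_apoly_le {D : ℕ} [NeZero D] {χ : DirichletCharacter ℂ D} (hD : 3 ≤ D)
    (hp : χ.IsPrimitive) (hℓ : 1 ≤ ell D) (x : Chr D) {B S : ℝ} (hB : 0 ≤ B) (hS : 0 ≤ S)
    {κs as : ℕ → ℂ} (ha : ∀ n : ℕ, ‖as n‖ ≤ B)
    (hL : ∀ s : ℂ, 5 / 4 ≤ s.re →
      ‖LSeries (fun m : ℕ => if ⌊bigP D ^ 2⌋₊ < m then κs m * x.ψ (m : ZMod x.p) else 0) s‖ ≤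
        B * S * ((⌊bigP D ^ 2⌋₊ : ℝ) + 1) ^ (5 / 4 - s.re))
    {s : ℂ} (h1 : 3 / 2 ≤ s.re) (h2 : s.re ≤ ell D ^ 9 + 1 / 2)
    (h3 : |s.im - 2 * π * t0 D| ≤ ell1 D) :
    ‖(Zpc χ x s)⁻¹ *
        LSeries (fun m : ℕ => if ⌊bigP D ^ 2⌋₊ < m then κs m * x.ψ (m : ZMod x.p) else 0) s *
        (∑ n ∈ Finset.Icc 1 ⌊2 * P4 D⌋₊, as n * conj (x.ψ (n : ZMod x.p)) * (n : ℂ) ^ (s - 1))‖ ≤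
      Real.exp 3 * B ^ 2 * S * (bigP D ^ 2 + 1) ^ 2 *
        (((D * x.p : ℕ) : ℝ) * t0 D * (⌊2 * P4 D⌋₊ : ℝ) / ((⌊bigP D ^ 2⌋₊ : ℝ) + 1)) ^ s.re := by
  have hD0 : 0 < D := by omega
  have ht01 : 1 ≤ t0 D := by rw [t0]; exact one_le_pow₀ hℓ
  have hprim : (psiChi χ x).IsPrimitive := psiChiPrimitive_holds D χ x hD hp
  have hk2 : 2 ≤ D * x.p := le_trans x.prime.two_le (Nat.le_mul_of_pos_left _ hD0)
  set σ := s.re with hσ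
  set kt : ℝ := ((D * x.p : ℕ) : ℝ) * t0 D with hkt
  set Y : ℝ := (⌊bigP D ^ 2⌋₊ : ℝ) + 1 with hY
  set Nr : ℝ := (⌊2 * P4 D⌋₊ : ℝ) with hNr
  have hkt1 : 1 ≤ kt := by
    have hk1 : (1 : ℝ) ≤ ((D * x.p : ℕ) : ℝ) := by exact_mod_cast le_trans one_le_two hk2
    rw [hkt]; nlinarith
  have hY1 : 1 ≤ Y := by rw [hY]; linarith [(Nat.cast_nonneg ⌊bigP D ^ 2⌋₊ : (0 : ℝ) ≤ _)]
  have hY0 : 0 < Y := by linarith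
  have hYle : Y ≤ bigP D ^ 2 + 1 := by
    rw [hY]; linarith [Nat.floor_le (show 0 ≤ bigP D ^ 2 by positivity)]
  have hN0 : 0 ≤ Nr := Nat.cast_nonneg _
  have hZ : ‖(Zpc χ x s)⁻¹‖ ≤ Real.exp 3 * kt ^ (σ - 1 / 2) := by
    rw [Zpc]; exact norm_Zfac_inv_le_of_isPrimitive hD hprim hk2 (by linarith) h2 h3
  have hLs := hL s (by linarith)
  have hA := norm_apoly_le_pow x ha (s := s) (by linarith)
  have hY54 : Y ^ (5 / 4 : ℝ) ≤ (bigP D ^ 2 + 1) ^ 2 :=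
    calc Y ^ (5 / 4 : ℝ) ≤ Y ^ (2 : ℝ) := Real.rpow_le_rpow_of_exponent_le hY1 (by norm_num)
      _ = Y ^ 2 := by norm_cast
      _ ≤ (bigP D ^ 2 + 1) ^ 2 := pow_le_pow_left₀ hY0.le hYle 2
  have hbk := rpow_bookkeeping hkt1 hY1 hN0 (σ := σ)
  have hb0 : 0 ≤ (kt * Nr / Y) ^ σ := Real.rpow_nonneg (div_nonneg (mul_nonneg (by linarith) hN0) hY0.le) _
  have he3 : 0 ≤ Real.exp 3 * B ^ 2 * S := mul_nonneg (mul_nonneg (Real.exp_pos 3).le (sq_nonneg B)) hS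
  have hZ0 : 0 ≤ Real.exp 3 * kt ^ (σ - 1 / 2) := mul_nonneg (Real.exp_pos 3).le (Real.rpow_nonneg (by linarith) _)
  have hL0 : 0 ≤ B * S * Y ^ (5 / 4 - σ) := mul_nonneg (mul_nonneg hB hS) (Real.rpow_nonneg hY0.le _)
  rw [norm_mul, norm_mul]
  calc ‖(Zpc χ x s)⁻¹‖ * ‖LSeries (fun m : ℕ => if ⌊bigP D ^ 2⌋₊ < m then κs m * x.ψ (m : ZMod x.p) else 0) s‖ *
        ‖∑ n ∈ Finset.Icc 1 ⌊2 * P4 D⌋₊, as n * conj (x.ψ (n : ZMod x.p)) * (n : ℂ) ^ (s - 1)‖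
      ≤ (Real.exp 3 * kt ^ (σ - 1 / 2)) * (B * S * Y ^ (5 / 4 - σ)) * (B * Nr ^ σ) :=
        mul_le_mul (mul_le_mul hZ hLs (norm_nonneg _) hZ0) hA (norm_nonneg _) (mul_nonneg hZ0 hL0)
    _ = Real.exp 3 * B ^ 2 * S * (kt ^ (σ - 1 / 2) * Y ^ (5 / 4 - σ) * Nr ^ σ) := by ring
    _ ≤ Real.exp 3 * B ^ 2 * S * (Y ^ (5 / 4 : ℝ) * (kt * Nr / Y) ^ σ) :=
        mul_le_mul_of_nonneg_left hbk he3
    _ ≤ Real.exp 3 * B ^ 2 * S * ((bigP D ^ 2 + 1) ^ 2 * (kt * Nr / Y) ^ σ) :=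
        mul_le_mul_of_nonneg_left (mul_le_mul_of_nonneg_right hY54 hb0) he3
    _ = _ := by rw [hkt, hNr, hY]; ring

/-! ### The contour shift -/

/-- **The (14.3) twin of `Z22:§7.u017`** ("moving the segment to `𝔍(𝓛⁹)` and applying (7.4) we obtain
`∫_{𝔍(1)} Z⁻¹(Σ_{m≥P²}…)A ω ds ≪ ε`", §7 p. 35, as invoked by §14 p. 76): for `|κ*| ≤ Bτ₅` and
`|a*| ≤ B`, eventually in `D`, for every `ψ ∈ Ψ`,
`‖∫_{𝔍(1)} Z(s,ψχ)⁻¹·(Σ_{m>⌊P²⌋}κ*(m)ψ(m)m^{−s})·(Σ_{n≤⌊2P₄⌋}a*(n)ψ̄(n)n^{s−1})·ω(s) ds‖ ≤ C·e^{−𝓛¹⁰/16}`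
with `C = e³B²S(max(C₇₄,0) + 4e^{1/4})` (`S = Σ τ₅(m)m^{−5/4}`, `C₇₄` the constant of (7.4)).
[cite: Zhang2022LandauSiegel, §14 (14.3) p. 76; §7 p. 35, tex L1890] -/
theorem tail (B : ℝ) : ∃ C : ℝ, ForAllLarge fun D _ χ => ∀ (x : Chr D) (κs as : ℕ → ℂ),
    Eq141 B κs → (∀ n : ℕ, ‖as n‖ ≤ B) →
      ‖intJ D 1 (fun s => (Zpc χ x s)⁻¹ *
          LSeries (fun m : ℕ => if ⌊bigP D ^ 2⌋₊ < m then κs m * x.ψ (m : ZMod x.p) else 0) s *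
          (∑ n ∈ Finset.Icc 1 ⌊2 * P4 D⌋₊,
            as n * conj (x.ψ (n : ZMod x.p)) * (n : ℂ) ^ (s - 1)) * omegaW D s)‖ ≤
        C * Real.exp (-(1 / 16) * ell D ^ 10) := by
  obtain ⟨S, hS0, HS⟩ := norm_LSeries_tail_le
  obtain ⟨C₇₄, D₁, H74⟩ := eq74_holds
  obtain ⟨D₂, hD₂⟩ := four_D_t0_sq_le_bigT
  obtain ⟨D₄, hD₄⟩ := exists_nat_forall_le_ell 40
  set C' : ℝ := max C₇₄ 0 with hC'
  refine ⟨Real.exp 3 * B ^ 2 * S * (C' + 4 * Real.exp (1 / 4)),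
    max (max (max D₁ D₂) D₄) 3, fun D _ χ hD hq hp x κs as hκ ha => ?_⟩
  have hD12 : max D₁ D₂ ≤ D := le_trans (le_trans (le_max_left _ _) (le_max_left _ _)) hD
  have hD1 : D₁ ≤ D := le_trans (le_max_left _ _) hD12
  have hT4 : 4 * (D : ℝ) * t0 D ^ 2 ≤ bigT D := hD₂ D (le_trans (le_max_right _ _) hD12)
  have hℓ40 : (40 : ℝ) ≤ ell D := hD₄ D (le_trans (le_trans (le_max_right _ _) (le_max_left _ _)) hD)
  have hD3 : 3 ≤ D := le_trans (le_max_right _ _) hD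
  have hℓ1 : 1 ≤ ell D := le_trans (by norm_num) hℓ40
  have hℓ9 : 1 ≤ ell D ^ 9 := one_le_pow₀ hℓ1
  have hL0 : 0 ≤ ell1 D := by rw [ell1]; exact pow_nonneg (le_trans zero_le_one hℓ1) _
  have hside : 0 < 2 * π * t0 D - ell1 D := twoPiT0_sub_ell1_pos₃ hℓ1
  have hT1 : 1 ≤ bigT D := by rw [bigT]; exact Real.one_le_exp (by positivity)
  have hB : 0 ≤ B := (norm_nonneg _).trans (ha 0)
  -- the base
  set b : ℝ := ((D * x.p : ℕ) : ℝ) * t0 D * (⌊2 * P4 D⌋₊ : ℝ) / ((⌊bigP D ^ 2⌋₊ : ℝ) + 1) with hb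
  have hbT : b ≤ (bigT D)⁻¹ := base_le_inv_bigT hℓ1 hT4 x
  have hb0 : 0 ≤ b := by
    have ht00 : 0 ≤ t0 D := by rw [t0]; exact pow_nonneg (le_trans zero_le_one hℓ1) _
    rw [hb]
    exact div_nonneg (mul_nonneg (mul_nonneg (Nat.cast_nonneg _) ht00) (Nat.cast_nonneg _))
      (by linarith [(Nat.cast_nonneg ⌊bigP D ^ 2⌋₊ : (0 : ℝ) ≤ _)])
  have hb1 : b ≤ 1 := hbT.trans (inv_le_one_of_one_le₀ hT1)
  -- the integrand and its holomorphy
  set Lf : ℂ → ℂ := fun s =>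
    LSeries (fun m : ℕ => if ⌊bigP D ^ 2⌋₊ < m then κs m * x.ψ (m : ZMod x.p) else 0) s with hLf
  set Af : ℂ → ℂ := fun s =>
    ∑ n ∈ Finset.Icc 1 ⌊2 * P4 D⌋₊, as n * conj (x.ψ (n : ZMod x.p)) * (n : ℂ) ^ (s - 1) with hAf
  set F : ℂ → ℂ := fun s => (Zpc χ x s)⁻¹ * Lf s * Af s * omegaW D s with hF
  have hopen : IsOpen {s : ℂ | 1 < s.re} := isOpen_lt continuous_const Complex.continuous_re
  have hLdiff : DifferentiableOn ℂ Lf {s : ℂ | 1 < s.re} := differentiableOn_LSeries_tail x hκ _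
  have hFat : ∀ s : ℂ, 1 < s.re → 0 < s.im → DifferentiableAt ℂ F s := by
    intro s hre him
    have h2 : DifferentiableAt ℂ Lf s := hLdiff.differentiableAt (hopen.mem_nhds hre)
    exact (((differentiableAt_Zpc_inv hD3 hp x him).mul h2).mul
      ((differentiable_apoly x as) s)).mul ((differentiable_omegaW D) s)
  have hdiff : DifferentiableOn ℂ F (Set.uIcc (1 / 2 + (1 : ℝ)) (1 / 2 + ell D ^ 9) ×ℂ
      Set.uIcc (2 * π * t0 D - ell1 D) (2 * π * t0 D + ell1 D)) := by
    intro s hs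
    have h := Complex.mem_reProdIm.mp hs
    rw [Set.uIcc_of_le (by linarith), Set.uIcc_of_le (by linarith)] at h
    exact (hFat s (by linarith [h.1.1]) (by linarith [h.2.1])).differentiableWithinAt
  -- the pointwise bound
  set G : ℝ := Real.exp 3 * B ^ 2 * S * (bigP D ^ 2 + 1) ^ 2 with hG
  have hG0 : 0 ≤ G := mul_nonneg (mul_nonneg (mul_nonneg (Real.exp_pos 3).le (sq_nonneg B)) hS0)
    (sq_nonneg _)
  have hprod : ∀ s : ℂ, 3 / 2 ≤ s.re → s.re ≤ ell D ^ 9 + 1 / 2 →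
      |s.im - 2 * π * t0 D| ≤ ell1 D → ‖(Zpc χ x s)⁻¹ * Lf s * Af s‖ ≤ G * b ^ s.re :=
    fun s h1 h2 h3 => norm_Zinv_tail_apoly_le hD3 hp hℓ1 x hB hS0 ha (HS x hκ _) h1 h2 h3
  -- Step 1: the segment `𝔍(𝓛⁹)`
  have hbpow : b ^ (ell D ^ 9 + 1 / 2) ≤ Real.exp (-ell D ^ 10) := base_pow_le hℓ1 hb0 hbT
  have hre : ∀ v : ℝ, (((ell D ^ 9 : ℝ) : ℂ) + s0 D + v * I).re = ell D ^ 9 + 1 / 2 := by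
    intro v; simp [s0, SmoothWeight.s0, -Complex.ofReal_pow]
  have him : ∀ v : ℝ, (((ell D ^ 9 : ℝ) : ℂ) + s0 D + v * I).im = 2 * π * t0 D + v := by
    intro v; simp [s0, SmoothWeight.s0, -Complex.ofReal_pow]
  have hright : ‖intJ D (ell D ^ 9) F‖ ≤ G * Real.exp (-ell D ^ 10) * C' := by
    refine (norm_intJ_le_absIntJ D hL0 _ F).trans ?_
    have hpt := continuous_segPoint (D := D) (ell D ^ 9)
    have hFc : ContinuousOn (fun v : ℝ => F (((ell D ^ 9 : ℝ) : ℂ) + s0 D + v * I))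
        (Set.uIcc (-ell1 D) (ell1 D)) := by
      intro v hv
      rw [Set.uIcc_of_le (by linarith)] at hv
      have h1 : DifferentiableAt ℂ F (((ell D ^ 9 : ℝ) : ℂ) + s0 D + v * I) :=
        hFat _ (by rw [hre]; linarith) (by rw [him]; linarith [hv.1])
      exact (ContinuousAt.comp (f := fun v : ℝ => ((ell D ^ 9 : ℝ) : ℂ) + s0 D + v * I)
        h1.continuousAt hpt.continuousAt).continuousWithinAt
    have hωc : Continuous fun v : ℝ => ‖omegaW D (((ell D ^ 9 : ℝ) : ℂ) + s0 D + v * I)‖ :=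
      (continuous_omegaW_seg (D := D) (ell D ^ 9)).norm
    have hptw : ∀ v ∈ Set.Icc (-ell1 D) (ell1 D),
        ‖F (((ell D ^ 9 : ℝ) : ℂ) + s0 D + v * I)‖ ≤
          G * Real.exp (-ell D ^ 10) * ‖omegaW D (((ell D ^ 9 : ℝ) : ℂ) + s0 D + v * I)‖ := by
      intro v hv
      have habs : |(((ell D ^ 9 : ℝ) : ℂ) + s0 D + v * I).im - 2 * π * t0 D| ≤ ell1 D := by
        rw [him, show 2 * π * t0 D + v - 2 * π * t0 D = v by ring]; exact abs_le.mpr ⟨hv.1, hv.2⟩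
      have h := hprod _ (by rw [hre]; linarith) (by rw [hre]) habs
      rw [hre] at h
      show ‖(Zpc χ x _)⁻¹ * Lf _ * Af _ * omegaW D _‖ ≤ _
      rw [norm_mul]
      exact mul_le_mul_of_nonneg_right (h.trans (mul_le_mul_of_nonneg_left hbpow hG0)) (norm_nonneg _)
    have hGe : 0 ≤ G * Real.exp (-ell D ^ 10) := mul_nonneg hG0 (Real.exp_pos _).le
    calc absIntJ D (ell D ^ 9) F
        = ∫ v in (-ell1 D)..ell1 D, ‖F (((ell D ^ 9 : ℝ) : ℂ) + s0 D + v * I)‖ := rfl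
      _ ≤ ∫ v in (-ell1 D)..ell1 D,
            G * Real.exp (-ell D ^ 10) * ‖omegaW D (((ell D ^ 9 : ℝ) : ℂ) + s0 D + v * I)‖ :=
          intervalIntegral.integral_mono_on (by linarith) (hFc.norm.intervalIntegrable)
            ((continuous_const.mul hωc).intervalIntegrable _ _) hptw
      _ = G * Real.exp (-ell D ^ 10) * absIntJ D (ell D ^ 9) (omegaW D) := by
          rw [intervalIntegral.integral_const_mul]; rfl
      _ ≤ G * Real.exp (-ell D ^ 10) * C' :=
          mul_le_mul_of_nonneg_left ((H74 D χ hD1 hq hp (ell D ^ 9) (by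
            rw [abs_of_nonneg (le_trans zero_le_one hℓ9)])).trans (le_max_left _ _)) hGe
  -- Step 2: the horizontal sides
  set Mh : ℝ := G * (2 * Real.exp (1 / 4) * Real.exp (-(ell D ^ 10 / 4))) with hMh
  have hM : ∀ u ∈ Set.Icc (1 / 2 + (1 : ℝ)) (1 / 2 + ell D ^ 9), ∀ v : ℝ, v ^ 2 = ell1 D ^ 2 →
      ‖F ((u : ℂ) + ((2 * π * t0 D + v : ℝ) : ℂ) * I)‖ ≤ Mh := by
    intro u hu v hv
    have hu0 : 3 / 2 ≤ u := by linarith [hu.1]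
    have hu1 : u ≤ ell D ^ 9 + 1 / 2 := by linarith [hu.2]
    have habs : |v| = ell1 D := by
      have h := (sq_eq_sq_iff_abs_eq_abs v (ell1 D)).mp hv
      rwa [abs_of_nonneg hL0] at h
    have hsre : ((u : ℂ) + ((2 * π * t0 D + v : ℝ) : ℂ) * I).re = u := by simp
    have hsim : ((u : ℂ) + ((2 * π * t0 D + v : ℝ) : ℂ) * I).im = 2 * π * t0 D + v := by simp
    have h := hprod ((u : ℂ) + ((2 * π * t0 D + v : ℝ) : ℂ) * I) (by rw [hsre]; exact hu0)
      (by rw [hsre]; exact hu1)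
      (by rw [hsim, show 2 * π * t0 D + v - 2 * π * t0 D = v by ring, habs])
    rw [hsre] at h
    have hbu : b ^ u ≤ 1 := Real.rpow_le_one hb0 hb1 (le_trans (by norm_num) hu0)
    have hω : ‖omegaW D ((u : ℂ) + ((2 * π * t0 D + v : ℝ) : ℂ) * I)‖ ≤
        2 * Real.exp (1 / 4) * Real.exp (-(ell D ^ 10 / 4)) :=
      norm_omegaW_side_le hD3 (le_trans (by norm_num) hu0) hu1 hv
    show ‖(Zpc χ x _)⁻¹ * Lf _ * Af _ * omegaW D _‖ ≤ Mh
    rw [norm_mul, hMh]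
    refine mul_le_mul (h.trans ?_) hω (norm_nonneg _) hG0
    calc G * b ^ u ≤ G * 1 := mul_le_mul_of_nonneg_left hbu hG0
      _ = G := mul_one _
  have hshift : ‖intJ D (ell D ^ 9) F - intJ D 1 F‖ ≤ (ell D ^ 9 - 1) * (Mh + Mh) := by
    refine norm_intJ_sub_intJ_le D hℓ9 hdiff (fun u hu => hM u hu _ rfl) fun u hu => ?_
    have e : (2 * π * t0 D - ell1 D : ℝ) = 2 * π * t0 D + -ell1 D := by ring
    rw [e]
    exact hM u hu _ (by ring)
  -- Step 3: assemble with the budgets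
  have hK : 0 ≤ Real.exp 3 * B ^ 2 * S := mul_nonneg (mul_nonneg (Real.exp_pos 3).le (sq_nonneg B)) hS0
  have hbud1 := budget_right hℓ40
  have hbud2 := budget_sides hℓ40
  calc ‖intJ D 1 F‖ = ‖intJ D (ell D ^ 9) F - (intJ D (ell D ^ 9) F - intJ D 1 F)‖ := by
        rw [sub_sub_cancel]
    _ ≤ ‖intJ D (ell D ^ 9) F‖ + ‖intJ D (ell D ^ 9) F - intJ D 1 F‖ := norm_sub_le _ _
    _ ≤ G * Real.exp (-ell D ^ 10) * C' + (ell D ^ 9 - 1) * (Mh + Mh) := add_le_add hright hshift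
    _ = Real.exp 3 * B ^ 2 * S * C' * ((bigP D ^ 2 + 1) ^ 2 * Real.exp (-ell D ^ 10)) +
          Real.exp 3 * B ^ 2 * S * (4 * Real.exp (1 / 4)) *
            ((ell D ^ 9 - 1) * ((bigP D ^ 2 + 1) ^ 2 * Real.exp (-(ell D ^ 10 / 4)))) := by
        rw [hMh, hG]; ring
    _ ≤ Real.exp 3 * B ^ 2 * S * C' * Real.exp (-(1 / 16) * ell D ^ 10) +
          Real.exp 3 * B ^ 2 * S * (4 * Real.exp (1 / 4)) * Real.exp (-(1 / 16) * ell D ^ 10) :=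
        add_le_add (mul_le_mul_of_nonneg_left hbud1 (mul_nonneg hK (le_max_right _ _)))
          (mul_le_mul_of_nonneg_left hbud2 (mul_nonneg hK (by positivity)))
    _ = Real.exp 3 * B ^ 2 * S * (C' + 4 * Real.exp (1 / 4)) * Real.exp (-(1 / 16) * ell D ^ 10) := by
        ring

end Literature.NumberTheory.LFunctions.Zhang2022.Typed.Sec14.Eq143

end
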